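import Literature.NumberTheory.LocalFields.UnramifiedQuadraticNormShiftedCounts
import HarnessLib

/-!
# Norms prescribed modulo `𝔪^j` in a class of POSITIVE ORDER: `#{z ∈ R ⧸ 𝔪^m : z σ̄z ≡ ϖ^{2ℓ}γ (mod 𝔪^j)} = (q+1)q^{2m−j−1}` — the residue count of Flicker's
# Prop. 13, cases (c)∕(e) (FILE 7 of the story `UnramifiedQuadraticNorm*`)
(Flicker (1998), *Elementary proof of the fundamental lemma for a unitary group*, Prop. 13 p. 93, case (c); Serre, *Local Fields*, V §2)

Topic `NumberTheory/LocalFields`, namespace `Literature.NumberTheory.LocalFields.UnramifiedQuadraticNorm`.  THEOREMS ONLY: no definition, no named fact, no instance, no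
notation, no `sorry`; kernel lane.  Cell `pub/hodgecm-mathlib`, road «D-N7-inert» ∕ MAP v3 «N7-ns COUNT FROM FLICKER», brick «PROP. 13 (13-ii) COUNT-0» FILE J3 (pen
F0P3b-p01 (g6) under A-p03 (g24) pen 1; census `F0/P3/F0P3b-p01/g6/CENSUS-F8-Prop13-CountZero-X1.F0P3bp01g6.md` §0 (ce)).  HC_CM is proved only modulo the 2 remaining
named inputs (hLiu418, h413) until rung 0 closes; this file is elementary DVR counting and proves no letter.

SETTING (as FILES 4–6): `R` a complete DVR with finite residue field, `|R ⧸ 𝔪| = q²`, `σ` an involution with an antisymmetric unit (`R = R_E`, unramified), `ϖ` a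
`σ`-FIXED uniformiser (`ϖ ∈ R_F`).  THE COUNT (Flicker p. 93, case (c): «we need to solve `(ζ + x)² − Dλ² ∈ γπ^{M−N}(1 + π^{2m−M}R)` … `∫ δ({Nz ∈ 1 + π^{2m−M}R}) dz`»):
for `2ℓ < j ≤ m` and a `σ`-fixed unit `γ`, a class `z mod 𝔪^m` with `z σ̄z ≡ ϖ^{2ℓ}γ (mod 𝔪^j)` has order EXACTLY `ℓ` (`shift_dvd_of_norm_congr`), so `z = ϖ^ℓ z₁` with
`z₁ mod 𝔪^{m−ℓ}` subject to `z₁ σ̄z₁ ≡ γ (mod 𝔪^{j−2ℓ})` — ★ FILE 4 `natCard_norm_congr_quotient_pow` at `(m−ℓ, j−2ℓ)`: **`q^{(m−ℓ)−(j−2ℓ)} · q^{m−ℓ−1}(q+1)`** `= (q+1)q^{2m−j−1}`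
(`natCard_norm_congr_shift`; the multiplication-by-`ϖ^ℓ` map `R ⧸ 𝔪^{m−ℓ} → R ⧸ 𝔪^m` is `Submodule.liftQ` of `mkQ ∘ mulLeft`, injective by cancellation in the DVR).
With `j = 2m − N`, `2ℓ = M − N` this is `(q+1)q^{N−1}`, the `z`-count of case (c); the remaining factors `(q+1)q^{m−1}` (the norm fibre of `uσu`) and `q^m` (the `N₀`-fibre)
are the sequel's junction (`(1+q⁻¹)²q^{2m+N}` = ★ `iThirteen` (c)).

## References
* [Flicker1998UnitaryFL] Y. Z. Flicker, *Elementary proof of the fundamental lemma for a unitary group*, Canad. J. Math. 50 (1998), 74–98: Prop. 13 p. 93.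
* [Serre1979] J.-P. Serre, *Local Fields*, GTM 67 (1979), Ch. V §2 Prop. 2–3.
-/

set_option autoImplicit false

namespace Literature.NumberTheory.LocalFields.UnramifiedQuadraticNorm

open IsLocalRing

universe u

variable {R : Type u} [CommRing R] (σ : R →+* R)

section Shift

variable [IsDomain R] [IsDiscreteValuationRing R]

/-- `𝔪^n = (ϖ^n)`: membership is divisibility by `ϖ^n`. [cite: Serre1979, Ch. I §1] -/
theorem mem_maximalIdeal_pow_iff_pow_dvd {p : R} (hp : Irreducible p) (n : ℕ) (x : R) : x ∈ maximalIdeal R ^ n ↔ p ^ n ∣ x := by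
  rw [hp.maximalIdeal_eq, Ideal.span_singleton_pow, Ideal.mem_span_singleton]

/-- **ORDER FORCING**: if `w σw ≡ ϖ^{2ℓ}γ (mod ϖ^j)` with `2ℓ < j` (σ fixing `ϖ`), then `ϖ^ℓ ∣ w` — the norm of `w = uϖ^n` is a unit times `ϖ^{2n}`, and
`n < ℓ` would make `ϖ^{2n}` the exact power dividing the left side. [cite: Flicker1998UnitaryFL, Prop. 13 p. 93] -/
theorem shift_dvd_of_norm_congr {p : R} (hp : Irreducible p) (hσp : σ p = p) {ℓ j : ℕ} (hj : 2 * ℓ < j) (γ : R) {w : R}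
    (hw : p ^ j ∣ w * σ w - p ^ (2 * ℓ) * γ) : p ^ ℓ ∣ w := by
  rcases eq_or_ne w 0 with rfl | hw0
  · exact dvd_zero _
  obtain ⟨n, u, rfl⟩ := IsDiscreteValuationRing.eq_unit_mul_pow_irreducible hw0 hp
  by_cases hn : ℓ ≤ n
  · exact Dvd.dvd.mul_left (pow_dvd_pow p hn) _
  · exfalso
    push Not at hn
    have hpr : Prime p := hp.prime
    -- `w σw − ϖ^{2ℓ}γ = ϖ^{2n} · (uσu − ϖ^{2(ℓ−n)}γ)` with the bracket a unit
    have hfac : (u : R) * p ^ n * σ ((u : R) * p ^ n) - p ^ (2 * ℓ) * γ =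
        p ^ (2 * n) * ((u : R) * σ (u : R) - p ^ (2 * (ℓ - n)) * γ) := by
      have h2 : 2 * ℓ = 2 * n + 2 * (ℓ - n) := by omega
      rw [map_mul, map_pow, hσp, h2, pow_add]; ring
    rw [hfac] at hw
    have hj' : p ^ (2 * n) * p ∣ p ^ (2 * n) * ((u : R) * σ (u : R) - p ^ (2 * (ℓ - n)) * γ) :=
      dvd_trans (by rw [← pow_succ]; exact pow_dvd_pow p (by omega)) hw
    have hpd : p ∣ (u : R) * σ (u : R) - p ^ (2 * (ℓ - n)) * γ :=
      (mul_dvd_mul_iff_left (pow_ne_zero _ hp.ne_zero)).1 hj'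
    have hpd' : p ∣ p ^ (2 * (ℓ - n)) * γ := Dvd.dvd.mul_right (dvd_pow_self p (by omega)) γ
    have hpu : p ∣ (u : R) * σ (u : R) := by
      have := dvd_add hpd hpd'; rwa [sub_add_cancel] at this
    have hunit : IsUnit ((u : R) * σ (u : R)) := (Units.isUnit u).mul ((Units.isUnit u).map σ)
    exact hp.not_isUnit (isUnit_of_dvd_unit hpu hunit)

end Shift

section Count

variable [IsDomain R] [IsDiscreteValuationRing R] [Finite (ResidueField R)] [IsAdicComplete (maximalIdeal R) R]
  (hσ : ∀ a, σ (σ a) = a) {a : R} (ha : IsUnit (σ a - a)) {q : ℕ} (hq : Nat.card (ResidueField R) = q ^ 2)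

include ha hq in
/-- **`#{z ∈ R ⧸ 𝔪^m : z σ̄z ≡ ϖ^{2ℓ}γ (mod 𝔪^j)} = q^{(m−ℓ)−(j−2ℓ)} · q^{m−ℓ−1}(q+1)`** (`= (q+1)q^{2m−j−1}`) for `2ℓ < j ≤ m`, `γ` a `σ`-fixed unit and `ϖ` a `σ`-fixed
uniformiser: the classes counted are `z = ϖ^ℓ z₁` (order forcing) with `z₁ mod 𝔪^{m−ℓ}` of norm `≡ γ (mod 𝔪^{j−2ℓ})` (★ `natCard_norm_congr_quotient_pow`); multiplication by `ϖ^ℓ`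
is injective `R ⧸ 𝔪^{m−ℓ} → R ⧸ 𝔪^m`.  Flicker p. 93: the `z`-integral of case (c). [cite: Flicker1998UnitaryFL, Prop. 13 p. 93] [cite: Serre1979, Ch. V §2 Prop. 3] -/
theorem natCard_norm_congr_shift {p : R} (hp : Irreducible p) (hσp : σ p = p) {m j ℓ : ℕ} (hj : 2 * ℓ < j) (hjm : j ≤ m)
    {γ : R} (hγ : IsUnit γ) (hσγ : σ γ = γ) :
    Nat.card {z : R ⧸ maximalIdeal R ^ m //
      Ideal.Quotient.factor (Ideal.pow_le_pow_right hjm) (z * Ideal.quotientMap (maximalIdeal R ^ m) σ (maximalIdeal_pow_le_comap σ hσ m) z) =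
        Ideal.Quotient.mk (maximalIdeal R ^ j) (p ^ (2 * ℓ) * γ)} =
      q ^ ((m - ℓ) - (j - 2 * ℓ)) * (q ^ ((m - ℓ) - 1) * (q + 1)) := by
  classical
  have hℓm : ℓ ≤ m := by omega
  have hk : 1 ≤ j - 2 * ℓ := by omega
  have hkm : j - 2 * ℓ ≤ m - ℓ := by omega
  rw [← natCard_norm_congr_quotient_pow σ hσ ha hq hk hkm hγ hσγ]
  -- notation
  set m' := m - ℓ with hm'
  set k' := j - 2 * ℓ with hk'
  have hmm : ℓ + m' = m := by omega
  have hjj : 2 * ℓ + k' = j := by omega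
  set σm := Ideal.quotientMap (maximalIdeal R ^ m) σ (maximalIdeal_pow_le_comap σ hσ m) with hσm
  set σm' := Ideal.quotientMap (maximalIdeal R ^ m') σ (maximalIdeal_pow_le_comap σ hσ m') with hσm'
  -- the multiplication-by-`ϖ^ℓ` map `g : R ⧸ 𝔪^{m'} → R ⧸ 𝔪^m`
  have hker : maximalIdeal R ^ m' ≤ LinearMap.ker ((Submodule.mkQ (maximalIdeal R ^ m)).comp (LinearMap.mulLeft R (p ^ ℓ))) := by
    intro w hw
    rw [LinearMap.mem_ker, LinearMap.comp_apply, LinearMap.mulLeft_apply, Submodule.mkQ_apply, Submodule.Quotient.mk_eq_zero,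
      mem_maximalIdeal_pow_iff_pow_dvd hp]
    rw [mem_maximalIdeal_pow_iff_pow_dvd hp] at hw
    rw [← hmm, pow_add]
    exact mul_dvd_mul_left _ hw
  set g : R ⧸ maximalIdeal R ^ m' →ₗ[R] R ⧸ maximalIdeal R ^ m :=
    Submodule.liftQ (maximalIdeal R ^ m') ((Submodule.mkQ (maximalIdeal R ^ m)).comp (LinearMap.mulLeft R (p ^ ℓ))) hker with hg
  have hgmk : ∀ w : R, g (Ideal.Quotient.mk (maximalIdeal R ^ m') w) = Ideal.Quotient.mk (maximalIdeal R ^ m) (p ^ ℓ * w) := fun w => by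
    rw [hg, ← Ideal.Quotient.mk_eq_mk, Submodule.liftQ_apply]; rfl
  -- the predicates
  set Pm : R ⧸ maximalIdeal R ^ m → Prop := fun z =>
    Ideal.Quotient.factor (Ideal.pow_le_pow_right hjm) (z * σm z) = Ideal.Quotient.mk (maximalIdeal R ^ j) (p ^ (2 * ℓ) * γ) with hPm
  set Pm' : R ⧸ maximalIdeal R ^ m' → Prop := fun z =>
    Ideal.Quotient.factor (Ideal.pow_le_pow_right hkm) (z * σm' z) = Ideal.Quotient.mk (maximalIdeal R ^ k') γ with hPm'
  -- the two predicates correspond under `g`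
  have hiff : ∀ w : R, Pm (g (Ideal.Quotient.mk _ w)) ↔ Pm' (Ideal.Quotient.mk _ w) := by
    intro w
    simp only [hPm, hPm', hgmk, hσm, hσm', Ideal.quotientMap_mk, ← map_mul, Ideal.Quotient.factor_mk, Ideal.Quotient.eq,
      mem_maximalIdeal_pow_iff_pow_dvd hp]
    rw [RingHom.map_mul, map_pow, hσp, show p ^ ℓ * w * (p ^ ℓ * σ w) - p ^ (2 * ℓ) * γ = p ^ (2 * ℓ) * (w * σ w - γ) by ring, ← hjj, pow_add]
    exact mul_dvd_mul_iff_left (pow_ne_zero _ hp.ne_zero)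
  -- the bijection `S' → T`, `z₁ ↦ ϖ^ℓ z₁`
  refine (Nat.card_congr (Equiv.ofBijective
    (fun z : {z : R ⧸ maximalIdeal R ^ m' // Pm' z} => (⟨g z.1, ?_⟩ : {z : R ⧸ maximalIdeal R ^ m // Pm z})) ⟨?_, ?_⟩)).symm
  · obtain ⟨w, hw⟩ := Ideal.Quotient.mk_surjective z.1
    have h := z.2
    rw [← hw] at h ⊢
    exact (hiff w).2 h
  · rintro ⟨z₁, h₁⟩ ⟨z₂, h₂⟩ h
    have h' : g z₁ = g z₂ := congrArg (fun x => x.1) h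
    obtain ⟨w₁, rfl⟩ := Ideal.Quotient.mk_surjective z₁
    obtain ⟨w₂, rfl⟩ := Ideal.Quotient.mk_surjective z₂
    apply Subtype.ext
    rw [hgmk, hgmk, Ideal.Quotient.eq, mem_maximalIdeal_pow_iff_pow_dvd hp, ← mul_sub, ← hmm, pow_add] at h'
    show Ideal.Quotient.mk _ w₁ = Ideal.Quotient.mk _ w₂
    rw [Ideal.Quotient.eq, mem_maximalIdeal_pow_iff_pow_dvd hp]
    exact (mul_dvd_mul_iff_left (pow_ne_zero _ hp.ne_zero)).1 h'
  · rintro ⟨z, hz⟩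
    obtain ⟨w, rfl⟩ := Ideal.Quotient.mk_surjective z
    -- order forcing: `w = ϖ^ℓ w₁`
    have hz' : p ^ j ∣ w * σ w - p ^ (2 * ℓ) * γ := by
      have h := hz
      simp only [hPm, hσm, Ideal.quotientMap_mk, ← map_mul, Ideal.Quotient.factor_mk, Ideal.Quotient.eq,
        mem_maximalIdeal_pow_iff_pow_dvd hp] at h
      exact h
    obtain ⟨w₁, rfl⟩ := shift_dvd_of_norm_congr σ hp hσp hj γ hz'
    have h₁ : Pm' (Ideal.Quotient.mk _ w₁) := (hiff w₁).1 (by rw [hgmk]; exact hz)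
    exact ⟨⟨Ideal.Quotient.mk _ w₁, h₁⟩, Subtype.ext (hgmk w₁)⟩

end Count

end Literature.NumberTheory.LocalFields.UnramifiedQuadraticNorm
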